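import Summits.QuantumFields.YangMills.Theorems.ColdStartUniversalityLatticeLangevinWilsonLogSobolevOfEntropyDecay
import Summits.QuantumFields.YangMills.Theorems.ColdStartUniversalityLatticeLangevinWilsonEntropyDecay
import Summits.QuantumFields.YangMills.Theorems.ColdStartUniversalityUniformColdStartMixingRungOfHarris
import HarnessLib

/-!
# Route `ColdStartUniversality` (fixed-cut-off package, entropy side): LOG-SOBOLEV ⟺ EXPONENTIAL DECAY OF ENTROPY for the SU(2)
# SZZ dynamics at every fixed cut-off (Bakry–Gentil–Ledoux Thm 5.2.1, both directions kernel-checked)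

Helper file (seat `ym-line-csu-p1`, g22; `--supports stmt-QuantumFields-27363`).  Packaging of g21's
`entropy_transition_le_exp_of_generatorLogSobolev` ((i)⇒(ii)) and g22's `generatorLogSobolev_of_entropy_decay` ((ii)⇒(i)):

* ★★ `generatorLogSobolev_iff_entropy_decay` — for `ρ > 0`, at every `(L, β')`: the generator-form log-Sobolev inequality
  `ρ·Ent_μ(F²) ≤ −∫ F 𝓛_{β'}f dμ` for all `C³` cylinders  ⟺  for EVERY Markov kernel family realising the SZZ transition laws, every
  positive `C³` compactly supported cylinder density `F` and every `t`: `Ent_μ(κ_t F) ≤ e^{−4ρt} Ent_μ(F)`;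
* ★ `generatorLogSobolev_iff_entropy_decay_exists` — the same with «for SOME realising kernel family» on the right (all realising
  families have the same action on bounded measurable functions; existence: `exists_transitionKernel`).

So the hypothesis `hLSgen` of the entropy line is EXACTLY exponential entropy decay at rate `4ρ` — the entropy twin of g18's
`uniformL2Gap_tfae` («hEquiv is a theorem»).  THEOREMS ONLY, no definition, no sorry.  RECORD-rung R3 plumbing at FIXED cut-off;
nothing K-uniform; no crux, rung or summit statement is proved; the Yang–Mills mass gap is NOT proved.
-/

set_option autoImplicit false

noncomputable section

namespace Summit.QuantumFields.YangMills.Theorems.ColdStartUniversality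

open MeasureTheory ProbabilityTheory Finset Filter Set Topology
open scoped BigOperators NNReal ENNReal
open Literature.Probability.Process Literature.MathematicalPhysics.QuantumFieldTheory
open Literature.MathematicalPhysics.QuantumLattice (fundamentalRep fundamentalLatticeRep continuous_fundamentalRep)

variable {L : ℕ} [NeZero L]

/-- ★★ **Log-Sobolev ⟺ exponential decay of entropy (BGL Thm 5.2.1) for the SZZ dynamics at a fixed cut-off**, `ρ > 0`:
the generator-form log-Sobolev inequality with constant `ρ` on `C³` cylinders holds for `μ_{β'}` iff along EVERY realising Markov
kernel family the entropy of every positive `C³` compactly supported cylinder density decays like `e^{−4ρt}`.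
[cite: BakryGentilLedoux2014, Thm 5.2.1] -/
theorem generatorLogSobolev_iff_entropy_decay (L : ℕ) [NeZero L] (β' : ℝ) {ρ : ℝ} (hρ : 0 < ρ) :
    (∀ (f : (Edge 3 L × Fin 2 × Fin 2 × Bool → ℝ) → ℝ), ContDiff ℝ 3 f →
        let coords : GaugeConfig 3 L (Matrix.specialUnitaryGroup (Fin 2) ℂ) → (Edge 3 L × Fin 2 × Fin 2 × Bool → ℝ) :=
          fun V q => (fun z : ℂ => if q.2.2.2 then z.im else z.re)
            ((fundamentalRep (Fin 2) (V q.1) : Matrix (Fin 2) (Fin 2) ℂ) q.2.1 q.2.2.1)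
        let gen : GaugeConfig 3 L (Matrix.specialUnitaryGroup (Fin 2) ℂ) → ℝ := fun V =>
          (∑ i : Edge 3 L × Fin 2 × Fin 2 × Bool, fderiv ℝ f (coords V) (Pi.single i 1) *
              (fun z : ℂ => if i.2.2.2 then z.im else z.re)
                ((latticeLangevinDynamics (fundamentalLatticeRep 2) β').drift
                  (matrixConfig (fundamentalRep (Fin 2)) V) i.1 i.2.1 i.2.2.1) +
          1 / 2 * ∑ i : Edge 3 L × Fin 2 × Fin 2 × Bool, ∑ j : Edge 3 L × Fin 2 × Fin 2 × Bool,
            fderiv ℝ (fun z => fderiv ℝ f z (Pi.single i 1)) (coords V) (Pi.single j 1) *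
              ∑ n : Edge 3 L × NoiseIdx 2,
                (if n.1 = i.1 then (fun z : ℂ => if i.2.2.2 then z.im else z.re)
                  ((latticeLangevinDynamics (fundamentalLatticeRep 2) β').noise
                    (matrixConfig (fundamentalRep (Fin 2)) V) i.1 n.2 i.2.1 i.2.2.1) else 0) *
                (if n.1 = j.1 then (fun z : ℂ => if j.2.2.2 then z.im else z.re)
                  ((latticeLangevinDynamics (fundamentalLatticeRep 2) β').noise
                    (matrixConfig (fundamentalRep (Fin 2)) V) j.1 n.2 j.2.1 j.2.2.1) else 0))
        ρ * ((∫ V, f (coords V) ^ 2 * Real.log (f (coords V) ^ 2) ∂(wilsonMeasure (d := 3) (L := L) (fundamentalRep (Fin 2)) β')) -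
            (∫ V, f (coords V) ^ 2 ∂(wilsonMeasure (d := 3) (L := L) (fundamentalRep (Fin 2)) β')) *
              Real.log (∫ V, f (coords V) ^ 2 ∂(wilsonMeasure (d := 3) (L := L) (fundamentalRep (Fin 2)) β'))) ≤
          -∫ V, f (coords V) * gen V ∂(wilsonMeasure (d := 3) (L := L) (fundamentalRep (Fin 2)) β')) ↔
    (∀ (κ : ℝ≥0 → Kernel (GaugeConfig 3 L (Matrix.specialUnitaryGroup (Fin 2) ℂ))
        (GaugeConfig 3 L (Matrix.specialUnitaryGroup (Fin 2) ℂ))) (_ : ∀ t, IsMarkovKernel (κ t)),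
      (∀ (t : ℝ≥0) (x : GaugeConfig 3 L (Matrix.specialUnitaryGroup (Fin 2) ℂ))
        (Ω : Type) [MeasurableSpace Ω] (P : Measure Ω) [IsProbabilityMeasure P]
        (W : ℝ≥0 → Ω → (Edge 3 L × NoiseIdx 2 → ℝ)) (hW : IsFlatBrownian W P)
        (U : ℝ≥0 → Ω → GaugeConfig 3 L (Matrix.specialUnitaryGroup (Fin 2) ℂ)),
        (∀ ω, U 0 ω = x) →
        (latticeLangevinDynamics (fundamentalLatticeRep 2) β').IsSolution (fundamentalRep (Fin 2))
          hW.natFiltration P W U →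
        κ t x = P.map (U t)) →
      ∀ (q : (Edge 3 L × Fin 2 × Fin 2 × Bool → ℝ) → ℝ), ContDiff ℝ 3 q → HasCompactSupport q →
      (∀ x : GaugeConfig 3 L (Matrix.specialUnitaryGroup (Fin 2) ℂ),
        0 < q (fun p => (fun z : ℂ => if p.2.2.2 then z.im else z.re)
          ((fundamentalRep (Fin 2) (x p.1) : Matrix (Fin 2) (Fin 2) ℂ) p.2.1 p.2.2.1))) →
      ∀ t : ℝ≥0,
      let Q : GaugeConfig 3 L (Matrix.specialUnitaryGroup (Fin 2) ℂ) → ℝ := fun x =>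
        q (fun p => (fun z : ℂ => if p.2.2.2 then z.im else z.re)
          ((fundamentalRep (Fin 2) (x p.1) : Matrix (Fin 2) (Fin 2) ℂ) p.2.1 p.2.2.1))
      (∫ x, (∫ y, Q y ∂(κ t x)) * Real.log (∫ y, Q y ∂(κ t x)) ∂(wilsonMeasure (d := 3) (L := L) (fundamentalRep (Fin 2)) β')) -
          (∫ x, (∫ y, Q y ∂(κ t x)) ∂(wilsonMeasure (d := 3) (L := L) (fundamentalRep (Fin 2)) β')) *
            Real.log (∫ x, (∫ y, Q y ∂(κ t x)) ∂(wilsonMeasure (d := 3) (L := L) (fundamentalRep (Fin 2)) β')) ≤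
        Real.exp (-4 * ρ * t) *
          ((∫ x, Q x * Real.log (Q x) ∂(wilsonMeasure (d := 3) (L := L) (fundamentalRep (Fin 2)) β')) -
            (∫ x, Q x ∂(wilsonMeasure (d := 3) (L := L) (fundamentalRep (Fin 2)) β')) *
              Real.log (∫ x, Q x ∂(wilsonMeasure (d := 3) (L := L) (fundamentalRep (Fin 2)) β')))) := by
  constructor
  · intro hLS κ hκ hreal q hq hqc hpos t
    haveI := hκ
    exact entropy_transition_le_exp_of_generatorLogSobolev L β' κ hreal hρ hLS hq hqc hpos t
  · intro hdec f hf
    obtain ⟨κ, hκM, -, hreal⟩ := exists_transitionKernel L β'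
    haveI := hκM
    exact generatorLogSobolev_of_entropy_decay L β' κ hreal (ρ := ρ) (hdec κ hκM hreal) f hf

end Summit.QuantumFields.YangMills.Theorems.ColdStartUniversality

end
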